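import Summits.Ventures.CertifiedArithmetic.LowPrec.GemmEnvelopeTransfer

/-!
# GEMM-level envelopes, part (m): the reverse transfer and the FACTOR-TWO SANDWICH (pub-lowprec gemm gen 22, LXX-m)

HONEST FRAMING: certified error envelopes and provably optimal rounding/accumulation schemes for
low-precision formats under stated cost models; every table by two implementations; no hardware or
vendor claims.

Part (k)/(l) transfer every per-vector cell into an MX masked block of the same class: `VEC-φ ≼ MX-φ-ceil`
on `C(κ)` for every `κ ≥ 1`.  The REVERSE transfer costs exactly a factor two in the class parameter: an
MX-ceil cell of a block in `C(κ)` has scaled magnitude `y = |x|/X ∈ (M/(2κ), M]` (the ceil scale is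
minimal: `X·M < 2·blockMax`), and such a `y` is realised by the per-vector masked vectors
`(M, 0, y_a, 0, …)·(0, M, y_b, 0, …)` (numerator `M`, scale `1`) inside the class `C(2κ)`.  Hence
`mx_cell_le_of_vec_bound_format` and `row_mxCeil_le_vec_doubled_format`: every `q` bounding the per-vector
error on `C(2κ)` bounds the MX-ceil error on `C(κ)` — for every `κ ≥ 1`, any element format with
`0 < maxRat`, blocks of length `≥ 3`.  Together with part (l) this is the FACTOR-TWO SANDWICH
`ENV_VEC(C(κ)) ≤ ENV_MXC(C(κ)) ≤ ENV_VEC(C(2κ))`, with no envelope value computed anywhere; the E4M3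
thresholds `θ = 258048/17` (MX) and `2θ = 516096/17` (per-vector) of parts (f)/(j) are its two faces.
E4M3 instance: `row_mxCeil_le_vecE4M3_doubled`.
[cite: RouhaniEtAl2023MX, §5.1, §6.3]; [cite: MicikeviciusEtAl2022, §3]
-/

namespace Summit.Ventures.CertifiedArithmetic.LowPrec.GemmEnvelope

open Finset
open Literature.ComputerArithmetic.FloatingPoint
open Literature.ComputerArithmetic.FloatingPoint.Format
open Literature.ComputerArithmetic.FloatingPoint.MiniFloat
open Literature.ComputerArithmetic.FloatingPoint.MXBlock
open Summit.Ventures.CertifiedArithmetic.LowPrec.SR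

/-- THE REVERSE MASKED-CELL TRANSFER (any element format `φ`, `0 < φ.maxRat`): if `q` bounds the per-vector-φ
GEMM error on `C(κ')` (blocks of length `n + 3`, `B ≥ 1`), `κ' ≥ 1`, then `q` bounds the relative error of
every MX-φ-ceil product cell `X_a q(aᵢ/X_a) · X_b q(bᵢ/X_b) − aᵢ bᵢ` of blocks `a, b` with
`blockMax a ≤ κ|aᵢ|`, `blockMax b ≤ κ|bᵢ|` and `2κ ≤ κ'`. [cite: RouhaniEtAl2023MX, §6.3] -/
theorem mx_cell_le_of_vec_bound_format (φ : Format) (hMpos : 0 < φ.maxRat) {B n : ℕ} (hB : 0 < B)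
    {κ κ' : ℚ} (hκ' : 1 ≤ κ') (hκκ : 2 * κ ≤ κ') (q : ℚ)
    (hY : ∀ (a b : Fin B → Fin (n + 3) → ℚ) (Aa Ab : ℚ),
      (∀ j i, |a j i| ≤ Aa ∧ (a j i = 0 ∨ Aa ≤ κ' * |a j i|)) →
      (∀ j i, |b j i| ≤ Ab ∧ (b j i = 0 ∨ Ab ≤ κ' * |b j i|)) →
      |∑ j, ∑ i, (Aa / φ.maxRat * (roundNE φ (a j i / (Aa / φ.maxRat))).toRat) *
          (Ab / φ.maxRat * (roundNE φ (b j i / (Ab / φ.maxRat))).toRat)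
          - ∑ j, ∑ i, a j i * b j i| ≤ q * ∑ j, ∑ i, |a j i * b j i|)
    {m : ℕ} (V W : Fin m → ℚ) (i : Fin m)
    (hV : V i = 0 ∨ blockMax V ≤ κ * |V i|) (hW : W i = 0 ∨ blockMax W ≤ κ * |W i|) :
    |(ceilScale φ V * (roundNE φ (V i / ceilScale φ V)).toRat) *
        (ceilScale φ W * (roundNE φ (W i / ceilScale φ W)).toRat) - V i * W i| ≤ q * |V i * W i| := by
  by_cases ha0 : V i = 0
  · rw [ha0, GemmEnvelope.scaled_zero φ (ceilScale φ V)]; simp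
  by_cases hb0 : W i = 0
  · rw [hb0, GemmEnvelope.scaled_zero φ (ceilScale φ W)]; simp
  have hapos : 0 < |V i| := abs_pos.mpr ha0
  have hbpos : 0 < |W i| := abs_pos.mpr hb0
  set M : ℚ := φ.maxRat with hMdef
  set X : ℚ := ceilScale φ V with hXdef
  set Y : ℚ := ceilScale φ W with hYdef
  have hX : 0 < X := ceilScale_pos φ V
  have hYp : 0 < Y := ceilScale_pos φ W
  set ya : ℚ := |V i| / X with hya
  set yb : ℚ := |W i| / Y with hyb
  have hya0 : 0 < ya := by positivity
  have hyb0 : 0 < yb := by positivity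
  have hyaM : ya ≤ M := mxCeil_scaled_le_maxRat φ V i hMpos
  have hybM : yb ≤ M := mxCeil_scaled_le_maxRat φ W i hMpos
  -- the ceil scale is minimal: `X·M < 2·blockMax ≤ 2κ|Vᵢ|`, so `M ≤ κ'·y`
  have hκa : M ≤ κ' * ya := by
    have h1 : blockMax V ≤ κ * |V i| := hV.resolve_left ha0
    have h2 := ceilScale_mul_maxRat_lt_two_mul hMpos (lt_of_lt_of_le hapos (abs_le_blockMax V i))
    have h3 : X * M < (2 * κ) * |V i| := by rw [hXdef, hMdef]; linarith
    have h4 : M < (2 * κ) * ya := by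
      rw [hya, mul_div_assoc', lt_div_iff₀ hX]; linarith
    nlinarith [mul_le_mul_of_nonneg_right hκκ hya0.le]
  have hκb : M ≤ κ' * yb := by
    have h1 : blockMax W ≤ κ * |W i| := hW.resolve_left hb0
    have h2 := ceilScale_mul_maxRat_lt_two_mul hMpos (lt_of_lt_of_le hbpos (abs_le_blockMax W i))
    have h3 : Y * M < (2 * κ) * |W i| := by rw [hYdef, hMdef]; linarith
    have h4 : M < (2 * κ) * yb := by
      rw [hyb, mul_div_assoc', lt_div_iff₀ hYp]; linarith
    nlinarith [mul_le_mul_of_nonneg_right hκκ hyb0.le]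
  have hκM : M ≤ κ' * M := by
    have := mul_le_mul_of_nonneg_right hκ' hMpos.le
    linarith
  have hMp : (0 : ℚ) < M := hMpos
  -- the per-vector witness vectors (as blocks, constant in the block index)
  set a' : Fin (n + 3) → ℚ :=
    Fin.cases M (Fin.cases (0 : ℚ) (Fin.cases ya (fun _ : Fin n => (0 : ℚ)))) with ha'
  set b' : Fin (n + 3) → ℚ :=
    Fin.cases (0 : ℚ) (Fin.cases M (Fin.cases yb (fun _ : Fin n => (0 : ℚ)))) with hb'
  have hmemA : ∀ (j : Fin B) (i : Fin (n + 3)), |(fun _ : Fin B => a') j i| ≤ M ∧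
      ((fun _ : Fin B => a') j i = 0 ∨ M ≤ κ' * |(fun _ : Fin B => a') j i|) := by
    intro j i
    show |a' i| ≤ M ∧ (a' i = 0 ∨ M ≤ κ' * |a' i|)
    rw [ha']
    refine Fin.cases ?_ (fun i₁ => Fin.cases ?_ (fun i₂ => Fin.cases ?_ (fun _ => ?_) i₂) i₁) i
    · simp only [Fin.cases_zero]; rw [abs_of_pos hMp]; exact ⟨le_rfl, Or.inr hκM⟩
    · simp only [Fin.cases_succ, Fin.cases_zero, abs_zero]
      exact ⟨hMp.le, by first | exact Or.inl rfl | exact Or.inl trivial⟩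
    · simp only [Fin.cases_succ, Fin.cases_zero]; rw [abs_of_pos hya0]; exact ⟨hyaM, Or.inr hκa⟩
    · simp only [Fin.cases_succ, abs_zero]
      exact ⟨hMp.le, by first | exact Or.inl rfl | exact Or.inl trivial⟩
  have hmemB : ∀ (j : Fin B) (i : Fin (n + 3)), |(fun _ : Fin B => b') j i| ≤ M ∧
      ((fun _ : Fin B => b') j i = 0 ∨ M ≤ κ' * |(fun _ : Fin B => b') j i|) := by
    intro j i
    show |b' i| ≤ M ∧ (b' i = 0 ∨ M ≤ κ' * |b' i|)
    rw [hb']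
    refine Fin.cases ?_ (fun i₁ => Fin.cases ?_ (fun i₂ => Fin.cases ?_ (fun _ => ?_) i₂) i₁) i
    · simp only [Fin.cases_zero, abs_zero]
      exact ⟨hMp.le, by first | exact Or.inl rfl | exact Or.inl trivial⟩
    · simp only [Fin.cases_succ, Fin.cases_zero]; rw [abs_of_pos hMp]; exact ⟨le_rfl, Or.inr hκM⟩
    · simp only [Fin.cases_succ, Fin.cases_zero]; rw [abs_of_pos hyb0]; exact ⟨hybM, Or.inr hκb⟩
    · simp only [Fin.cases_succ, abs_zero]
      exact ⟨hMp.le, by first | exact Or.inl rfl | exact Or.inl trivial⟩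
  -- the per-vector scale of the witness is `M/M = 1`
  have hs : M / M = 1 := div_self (ne_of_gt hMpos)
  set Qa : ℚ := (roundNE φ ya).toRat with hQa
  set Qb : ℚ := (roundNE φ yb).toRat with hQb
  have hS1 : ∑ i, (roundNE φ (a' i)).toRat * (roundNE φ (b' i)).toRat = Qa * Qb := by
    rw [Fin.sum_univ_succ, Fin.sum_univ_succ, Fin.sum_univ_succ, ha', hb', hQa, hQb]
    simp only [Fin.cases_zero, Fin.cases_succ, toRat_roundNE_zero, mul_zero, zero_mul, zero_add, add_zero,
      sum_const_zero]
  have hS2 : ∑ i, a' i * b' i = ya * yb := by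
    rw [Fin.sum_univ_succ, Fin.sum_univ_succ, Fin.sum_univ_succ, ha', hb']
    simp only [Fin.cases_zero, Fin.cases_succ, mul_zero, zero_mul, zero_add, add_zero, sum_const_zero]
  have hS3 : ∑ i, |a' i * b' i| = ya * yb := by
    rw [Fin.sum_univ_succ, Fin.sum_univ_succ, Fin.sum_univ_succ, ha', hb']
    simp only [Fin.cases_zero, Fin.cases_succ, mul_zero, zero_mul, abs_zero, zero_add, add_zero,
      sum_const_zero, abs_of_pos (mul_pos hya0 hyb0)]
  have hw := hY (fun _ => a') (fun _ => b') M M hmemA hmemB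
  simp only [hs, div_one, one_mul, hS1, hS2, hS3, sum_const, card_univ, Fintype.card_fin,
    nsmul_eq_mul] at hw
  have hBq : (0 : ℚ) < (B : ℚ) := by exact_mod_cast hB
  have hcell : |Qa * Qb - ya * yb| ≤ q * (ya * yb) := by
    have e1 : (B : ℚ) * (Qa * Qb) - (B : ℚ) * (ya * yb) = (B : ℚ) * (Qa * Qb - ya * yb) := by ring
    rw [e1, abs_mul, abs_of_pos hBq] at hw
    have e2 : q * ((B : ℚ) * (ya * yb)) = (B : ℚ) * (q * (ya * yb)) := by ring
    rw [e2] at hw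
    exact le_of_mul_le_mul_left hw hBq
  -- back to the MX cell through the sign normal forms
  obtain ⟨σa, hσa, hae, hqa⟩ := scaled_sign_form φ X (V i)
  obtain ⟨σb, hσb, hbe, hqb⟩ := scaled_sign_form φ Y (W i)
  have haX : |V i| = X * ya := by rw [hya]; field_simp
  have hbY : |W i| = Y * yb := by rw [hyb]; field_simp
  have hab : V i * W i = σa * σb * (X * Y) * (ya * yb) := by
    calc V i * W i = (σa * |V i|) * (σb * |W i|) := by rw [← hae, ← hbe]
      _ = σa * σb * (X * Y) * (ya * yb) := by rw [haX, hbY]; ring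
  have hXY : 0 < X * Y := mul_pos hX hYp
  have hprod : X * (roundNE φ (V i / X)).toRat * (Y * (roundNE φ (W i / Y)).toRat) - V i * W i
      = σa * σb * (X * Y) * (Qa * Qb - ya * yb) := by
    rw [hqa, hqb, ← hya, ← hyb, ← hQa, ← hQb, hab]; ring
  have habs : |V i * W i| = X * Y * (ya * yb) := by
    rw [hab, abs_mul, abs_mul, abs_mul, hσa, hσb, abs_of_pos hXY, abs_of_pos (mul_pos hya0 hyb0)]; ring
  rw [hprod, habs, abs_mul, abs_mul, abs_mul, hσa, hσb, abs_of_pos hXY, one_mul, one_mul]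
  nlinarith [mul_le_mul_of_nonneg_left hcell hXY.le]

/-- **`MX-φ-ceil on C(κ) ≼ VEC-φ on C(2κ)` FOR EVERY `κ ≥ 1`, ANY ELEMENT FORMAT** (blocks of length `≥ 3`,
exact accumulation): every `q` bounding the per-vector GEMM error on `C(2κ)` bounds the MX ceil-scale GEMM
error on `C(κ)`.  With part (l) this is the factor-two sandwich `ENV_VEC(κ) ≤ ENV_MXC(κ) ≤ ENV_VEC(2κ)`.
[cite: RouhaniEtAl2023MX, §5.1, §6.3] -/
theorem row_mxCeil_le_vec_doubled_format (φ : Format) (hMpos : 0 < φ.maxRat) {B k : ℕ} (hB : 0 < B)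
    (hk : 3 ≤ k) {κ : ℚ} (hκ : 1 ≤ κ) (q : ℚ)
    (hY : ∀ (a b : Fin B → Fin k → ℚ) (Aa Ab : ℚ),
      (∀ j i, |a j i| ≤ Aa ∧ (a j i = 0 ∨ Aa ≤ (2 * κ) * |a j i|)) →
      (∀ j i, |b j i| ≤ Ab ∧ (b j i = 0 ∨ Ab ≤ (2 * κ) * |b j i|)) →
      |∑ j, ∑ i, (Aa / φ.maxRat * (roundNE φ (a j i / (Aa / φ.maxRat))).toRat) *
          (Ab / φ.maxRat * (roundNE φ (b j i / (Ab / φ.maxRat))).toRat)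
          - ∑ j, ∑ i, a j i * b j i| ≤ q * ∑ j, ∑ i, |a j i * b j i|)
    (a b : Fin B → Fin k → ℚ) (Aa Ab : ℚ)
    (ha : ∀ j i, |a j i| ≤ Aa ∧ (a j i = 0 ∨ Aa ≤ κ * |a j i|))
    (hb : ∀ j i, |b j i| ≤ Ab ∧ (b j i = 0 ∨ Ab ≤ κ * |b j i|)) :
    |∑ j, ∑ i, (ceilScale φ (a j) * (roundNE φ (a j i / ceilScale φ (a j))).toRat) *
        (ceilScale φ (b j) * (roundNE φ (b j i / ceilScale φ (b j))).toRat)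
        - ∑ j, ∑ i, a j i * b j i| ≤ q * ∑ j, ∑ i, |a j i * b j i| := by
  obtain ⟨n, rfl⟩ : ∃ n, k = n + 3 := ⟨k - 3, by omega⟩
  have hclass : ∀ (V : Fin (n + 3) → ℚ) (A : ℚ), (∀ i, |V i| ≤ A ∧ (V i = 0 ∨ A ≤ κ * |V i|)) →
      ∀ i, V i = 0 ∨ blockMax V ≤ κ * |V i| := by
    intro V A h i
    rcases (h i).2 with h0 | h1
    · exact Or.inl h0
    · exact Or.inr (le_trans (blockMax_le_of_forall_le (le_trans (abs_nonneg _) (h i).1) fun i' => (h i').1) h1)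
  have hcell : ∀ j i,
      |(ceilScale φ (a j) * (roundNE φ (a j i / ceilScale φ (a j))).toRat) *
          (ceilScale φ (b j) * (roundNE φ (b j i / ceilScale φ (b j))).toRat) - a j i * b j i|
        ≤ q * |a j i * b j i| :=
    fun j i => mx_cell_le_of_vec_bound_format φ hMpos hB (by linarith) le_rfl q hY (a j) (b j) i
      (hclass (a j) Aa (ha j) i) (hclass (b j) Ab (hb j) i)
  rw [← sum_sub_distrib]
  simp_rw [← sum_sub_distrib]
  refine le_trans (abs_sum_le_sum_abs _ _) ?_
  refine le_trans (sum_le_sum fun j _ => abs_sum_le_sum_abs _ _) ?_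
  rw [mul_sum]
  refine sum_le_sum fun j _ => ?_
  rw [mul_sum]
  exact sum_le_sum fun i _ => hcell j i

/-- The E4M3 instance: **`MXC on C(κ) ≼ VEC-E4M3 on C(2κ)` for every `κ ≥ 1`** (blocks `≥ 3`); with
`row_vecE4M3_le_mxCeil_transfer` the factor-two sandwich for E4M3, whose two faces are the thresholds
`θ = 258048/17` and `2θ = 516096/17` of parts (f)/(j). [cite: MicikeviciusEtAl2022, §3] -/
theorem row_mxCeil_le_vecE4M3_doubled {B k : ℕ} (hB : 0 < B) (hk : 3 ≤ k) {κ : ℚ} (hκ : 1 ≤ κ) (q : ℚ)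
    (hY : ∀ (a b : Fin B → Fin k → ℚ) (Aa Ab : ℚ),
      (∀ j i, |a j i| ≤ Aa ∧ (a j i = 0 ∨ Aa ≤ (2 * κ) * |a j i|)) →
      (∀ j i, |b j i| ≤ Ab ∧ (b j i = 0 ∨ Ab ≤ (2 * κ) * |b j i|)) →
      |∑ j, ∑ i, (Aa / E4M3.maxRat * (roundNE E4M3 (a j i / (Aa / E4M3.maxRat))).toRat) *
          (Ab / E4M3.maxRat * (roundNE E4M3 (b j i / (Ab / E4M3.maxRat))).toRat)
          - ∑ j, ∑ i, a j i * b j i| ≤ q * ∑ j, ∑ i, |a j i * b j i|)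
    (a b : Fin B → Fin k → ℚ) (Aa Ab : ℚ)
    (ha : ∀ j i, |a j i| ≤ Aa ∧ (a j i = 0 ∨ Aa ≤ κ * |a j i|))
    (hb : ∀ j i, |b j i| ≤ Ab ∧ (b j i = 0 ∨ Ab ≤ κ * |b j i|)) :
    |∑ j, ∑ i, (ceilScale E4M3 (a j) * (roundNE E4M3 (a j i / ceilScale E4M3 (a j))).toRat) *
        (ceilScale E4M3 (b j) * (roundNE E4M3 (b j i / ceilScale E4M3 (b j))).toRat)
        - ∑ j, ∑ i, a j i * b j i| ≤ q * ∑ j, ∑ i, |a j i * b j i| := by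
  have hM : 0 < E4M3.maxRat := by
    have h : E4M3.maxRat = 448 := by decide +kernel
    rw [h]; norm_num
  exact row_mxCeil_le_vec_doubled_format E4M3 hM hB hk hκ q hY a b Aa Ab ha hb

end Summit.Ventures.CertifiedArithmetic.LowPrec.GemmEnvelope
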